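import Summits.ValiantsHypothesis.ValiantsHypothesis.Theorems.SymmetroidDescartesDerivedPencilRolleWalkDefs

/-!
# Route SymmetroidDescartes — refutation of `DerivedPencilRolle` (stmt-ValiantsHypothesis-18500):
the staircase family — definitions

Definitions of the STAIRCASE FAMILY (line `staircase-refutation`, blueprint
`Cruxes/DerivedPencilRolle/Lines/staircase-refutation.md`): parameters `hw, Q, P_k`, exponent table,
the staircase gadget `J_k(p)` on `ℕ × Bool`, the recursive gadget `𝒢_k(p) = 𝒢_{k-1}(p−P_k) ++ J_k(p) ++
𝒢_{k-1}(P_k)`, the canonical walks, the value function and the predicates (`InCore`, `Law`, `RowStep`,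
`NegFree`) used by the proof files `…StairGadget`, `…StairCells`, `…StairLaw`, `…Staircase`.
Vertex `(ρ, false)` is row `ρ` at the base, `(ρ, true)` is row `ρ` while climbing.
-/

-- single-conjunct layout: Sub = Summit, duplicated namespace component intended
set_option linter.dupNamespace false

namespace Summit.ValiantsHypothesis.ValiantsHypothesis.Theorems.SymmetroidDescartes.DPR

open scoped BigOperators

section
variable (n L : ℕ)

/-- Half-width of a level-`k` cell: `hw k = (n+2)^(L+1-k)` (the cell width is `2·hw k`). [folklore] -/
def hw (k : ℕ) : ℕ := (n + 2) ^ (L + 1 - k)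

/-- The quantum base `Q = 2^(L+3) · (n+2)^(L+1)`. [folklore] -/
def bigQ : ℕ := 2 ^ (L + 3) * (n + 2) ^ (L + 1)

/-- The slope quantum of level `k`: `P k = Q^(L+1-k)` (coarser levels get larger quanta). [folklore] -/
def slopeP (k : ℕ) : ℕ := bigQ n L ^ (L + 1 - k)

/-- The exponent table of the `L+1` classes: class `0` is flat (exponent `0`), class `k ≥ 1` has
exponent `P k`. [folklore] -/
def expo : Fin (L + 1) → ℕ := fun i => if i.val = 0 then 0 else slopeP n L i.val

/-- The class index of level `k` (truncated at `L`). [folklore] -/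
def cl (k : ℕ) : Fin (L + 1) := ⟨min k L, by omega⟩

/-- A flat edge (class `0`, positive sign) of weight `a`. [folklore] -/
def flatE (a : ℤ) : WEdge (L + 1) := ⟨a, ⟨0, Nat.succ_pos L⟩, false⟩

/-- Entry layer of `J_k(p)`: `(ρ, base) → (ρ, climb)` with weight `p · ρ · (2 hw k)`. [folklore] -/
def entryLayer (k : ℕ) (p : ℤ) : WLayer (ℕ × Bool) (L + 1) := fun v v' =>
  if v.2 = false ∧ v'.2 = true ∧ v'.1 = v.1 then
    some (flatE L (p * v.1 * (2 * hw n L k))) else none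

/-- Climb layer number `s` of `J_k(p)`: an "up" edge `(ρ, climb) → (ρ+1, climb)` of class `k`,
weight `P_k · (2 hw k) · (s+2) + p · (ρ − s) · (2 hw k)` and negative sign iff `k = L`; and the flat
edges `(ρ, ·) → (ρ, base)` of weight `0`. [folklore] -/
def climbLayer (k : ℕ) (p : ℤ) (s : ℕ) : WLayer (ℕ × Bool) (L + 1) := fun v v' =>
  if v.2 = true ∧ v'.2 = true ∧ v'.1 = v.1 + 1 then
    some ⟨(slopeP n L k : ℤ) * (2 * hw n L k) * (s + 2) + p * ((v.1 : ℤ) - s) * (2 * hw n L k),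
      cl L k, decide (k = L)⟩
  else if v'.2 = false ∧ v'.1 = v.1 then some (flatE L 0) else none

/-- `m` consecutive climb layers starting with layer number `s`. [folklore] -/
def climbs (k : ℕ) (p : ℤ) : ℕ → ℕ → List (WLayer (ℕ × Bool) (L + 1))
  | _, 0 => []
  | s, m + 1 => climbLayer n L k p s :: climbs k p (s + 1) m

/-- Exit layer: `(ρ, ·) → (ρ, base)` with weight `0`. [folklore] -/
def exitLayer : WLayer (ℕ × Bool) (L + 1) := fun v v' =>
  if v'.2 = false ∧ v'.1 = v.1 then some (flatE L 0) else none

/-- The staircase gadget `J_k(p)`: entry, `n − 1` climb layers, exit (`n + 1` layers). [folklore] -/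
def stairJ (k : ℕ) (p : ℤ) : List (WLayer (ℕ × Bool) (L + 1)) :=
  entryLayer n L k p :: (climbs n L k p 0 (n - 1) ++ [exitLayer L])

/-- The recursive gadget `𝒢_k(p) = 𝒢_{k-1}(p − P_k) ++ J_k(p) ++ 𝒢_{k-1}(P_k)`, `𝒢_0 = []`. [folklore] -/
def gad : ℕ → ℤ → List (WLayer (ℕ × Bool) (L + 1))
  | 0, _ => []
  | k + 1, p => gad k (p - slopeP n L (k + 1)) ++ (stairJ n L (k + 1) p ++ gad k (slopeP n L (k + 1)))

/-- The walk through `m` climb layers that climbs `r` times from `(ρ, climb)` and then stays at the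
base. [folklore] -/
def climbWalk : ℕ → ℕ → ℕ → List (ℕ × Bool)
  | _, 0, _ => []
  | ρ, m + 1, 0 => (ρ, false) :: climbWalk ρ m 0
  | ρ, m + 1, r + 1 => (ρ + 1, true) :: climbWalk (ρ + 1) m r

/-- The staircase walk `stair(e, r)` through `J_k(p)` from `(e, base)`: enter, climb `r` times, stay,
exit at `(e + r, base)`. [folklore] -/
def stairWalk (e r : ℕ) : List (ℕ × Bool) :=
  (e, true) :: (climbWalk e (n - 1) r ++ [(e + r, false)])

/-- Closed form of the cost of `stair(e, r)` through `J_k(p)` at parameter `lam`: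
`P_k · hw_k · r(r+3) + p · e · (2 hw_k) · (1 + r) − P_k · r · lam`. [folklore] -/
def stairCost (k : ℕ) (p : ℤ) (e r : ℕ) (lam : ℤ) : ℤ :=
  (slopeP n L k : ℤ) * hw n L k * (r * (r + 3)) + p * e * (2 * hw n L k) * (1 + r)
    - (slopeP n L k : ℤ) * r * lam

/-- Closed form of the cost of climbing `r` times through climb layers `s, s+1, …` from row `ρ`:
`P_k · hw_k · (2rs + r(r+3)) + p · (ρ − s) · (2 hw_k) · r − P_k · r · lam`. [folklore] -/
def climbCost (k : ℕ) (p : ℤ) (s ρ r : ℕ) (lam : ℤ) : ℤ :=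
  (slopeP n L k : ℤ) * hw n L k * (2 * r * s + r * (r + 3)) + p * ((ρ : ℤ) - s) * (2 * hw n L k) * r
    - (slopeP n L k : ℤ) * r * lam

/-- Location `α_k(j)` of the level-`k` cell number `j` (digits of `j` in base `n`, the last digit
being the finest): `α_{k+1}(j) = α_k(j / n) + 2 hw_{k+1} · (1 + j % n)`. [folklore] -/
def loc : ℕ → ℕ → ℕ
  | 0, _ => 0
  | k + 1, j => loc k (j / n) + 2 * hw n L (k + 1) * (1 + j % n)

/-- Exit shift `σ_k(j)`: the canonical walk of `𝒢_k` entered at row `i` in cell `j` leaves at row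
`i + σ_k(j)`; `σ_{k+1}(j) = 2 σ_k(j / n) + j % n`. [folklore] -/
def sig : ℕ → ℕ → ℕ
  | 0, _ => 0
  | k + 1, j => 2 * sig k (j / n) + j % n

/-- The canonical walk of `𝒢_k(p)` from `(i, base)` in cell `j`:
canonical walk of the first child, the staircase `stair(e, j % n)` from the exit row `e`, canonical
walk of the second child. [folklore] -/
def canon : ℕ → ℤ → ℕ → ℕ → List (ℕ × Bool)
  | 0, _, _, _ => []
  | k + 1, p, i, j =>
      canon k (p - slopeP n L (k + 1)) i (j / n) ++
        (stairWalk n (i + sig n k (j / n)) (j % n) ++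
          canon k (slopeP n L (k + 1)) (i + sig n k (j / n) + j % n) (j / n))

/-- The value function: the cost of the canonical walk, defined by the same recursion. [folklore] -/
def val : ℕ → ℤ → ℕ → ℕ → ℤ → ℤ
  | 0, _, _, _, _ => 0
  | k + 1, p, i, j, lam =>
      val k (p - slopeP n L (k + 1)) i (j / n) lam +
        (stairCost n L (k + 1) p (i + sig n k (j / n)) (j % n) lam +
          val k (slopeP n L (k + 1)) (i + sig n k (j / n) + j % n) (j / n) lam)

/-- A layer whose edges keep the row or raise it by one. [folklore] -/
def RowStep {K : ℕ} (l : WLayer (ℕ × Bool) K) : Prop :=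
  ∀ v v' e, l v v' = some e → v.1 ≤ v'.1 ∧ v'.1 ≤ v.1 + 1

/-- `λ` lies in the core of the level-`k` cell `j`: at distance at least `2 hw_{k+1}` from both ends of
the cell `[α_k(j), α_k(j) + 2 hw_k]`. [folklore] -/
def InCore (k j : ℕ) (lam : ℤ) : Prop :=
  (loc n L k j : ℤ) + 2 * hw n L (k + 1) ≤ lam ∧ lam + 2 * hw n L (k + 1) ≤ loc n L k j + 2 * hw n L k

/-- The value of choosing digit `r` at the staircase `J_{k+1}(p)` from row `e` and continuing
canonically through the second child. [folklore] -/
def fval (k : ℕ) (p : ℤ) (e r d : ℕ) (lam : ℤ) : ℤ :=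
  stairCost n L (k + 1) p e r lam + val n L k (slopeP n L (k + 1)) (e + r) d lam

/-- The row bound used in the analysis: `Rtot = 2^(L+1) (n+2)^L`. [folklore] -/
def Rtot : ℕ := 2 ^ (L + 1) * (n + 2) ^ L

/-- The gap of level `k`: `P_k · hw_{k+1}`. [folklore] -/
def gapZ (k : ℕ) : ℤ := (slopeP n L k : ℤ) * hw n L (k + 1)

/-- THE LAW of the level-`k` gadgets: for every admissible parameter `p` (`|p| ≤ 2 P_{k+1}`), entering
row `i` (with room for the gadget below `Rtot`), cell `j` and parameter `λ` in the core of the cell,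
every walk from `(i, base)` other than the canonical one costs at least `val + gap_k`. [folklore] -/
def Law (k : ℕ) : Prop :=
  ∀ (p : ℤ) (i j : ℕ) (lam : ℤ), |p| ≤ 2 * slopeP n L (k + 1) → i + (2 ^ k - 1) * (n + 1) ≤ Rtot n L →
    InCore n L k j lam → ∀ w : List (ℕ × Bool), w ≠ canon n L k p i j →
      ((val n L k p i j lam + gapZ n L k : ℤ) : WithTop ℤ) ≤ walkCost (expo n L) lam (gad n L k p) (i, false) w

/-- Test parameter of the finest cell `j`: `λ_j = α_L(j) + 2` (an integer point of its core). [folklore] -/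
def lamOf (j : ℕ) : ℤ := loc n L L j + 2

/-- A layer none of whose edges carries a negative sign. [folklore] -/
def NegFree {K : ℕ} (l : WLayer (ℕ × Bool) K) : Prop := ∀ v v' e, l v v' = some e → e.neg = false

/-- The embedding of the finite rows. [folklore] -/
def iota (R : ℕ) (v : Fin R × Bool) : ℕ × Bool := (v.1.val, v.2)

/-- Restriction of a layer to the finite rows. [folklore] -/
def finLayer (R : ℕ) {K : ℕ} (l : WLayer (ℕ × Bool) K) : WLayer (Fin R × Bool) K :=
  fun v v' => l (iota R v) (iota R v')

/-- Lifting a vertex with a small row to the finite rows. [folklore] -/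
def liftV (R : ℕ) (hR : 0 < R) (v : ℕ × Bool) : Fin R × Bool := (⟨v.1 % R, Nat.mod_lt _ hR⟩, v.2)

/-- Unfolding `climbs` (zero layers). [folklore] -/
@[simp] theorem climbs_zero (k : ℕ) (p : ℤ) (s : ℕ) : climbs n L k p s 0 = [] := rfl

/-- Unfolding `climbs` (one more layer). [folklore] -/
@[simp] theorem climbs_succ (k : ℕ) (p : ℤ) (s m : ℕ) :
    climbs n L k p s (m + 1) = climbLayer n L k p s :: climbs n L k p (s + 1) m := rfl

/-- `climbs … s m` has `m` layers. [folklore] -/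
@[simp] theorem length_climbs (k : ℕ) (p : ℤ) : ∀ (s m : ℕ), (climbs n L k p s m).length = m
  | _, 0 => rfl
  | s, m + 1 => by simp [length_climbs k p (s + 1) m]

end

/-- Registered stub of this definitions file: the climb block has the announced number of layers. [folklore] -/
theorem stub_stairDefs : ∀ (n L k : ℕ) (p : ℤ) (s m : ℕ), (climbs n L k p s m).length = m :=
  fun n L k p s m => length_climbs n L k p s m


end Summit.ValiantsHypothesis.ValiantsHypothesis.Theorems.SymmetroidDescartes.DPR
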